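import Summits.CriticalPhenomena.PercolationContinuityZ3.Theorems.Transplant.PlanarSkeletonFrmScaledRayHull
import Summits.CriticalPhenomena.PercolationContinuityZ3.Theorems.Transplant.PlanarSkeletonFrmScaledEscape
import Summits.CriticalPhenomena.PercolationContinuityZ3.Theorems.Transplant.PlanarSkeletonFrmRayStrict
import Literature.Probability.LatticeModels.MedialPerturbation
import Literature.Barriers.CriticalPhenomena.PositionSpaceRGNonGibbsianIsraelLattice
import HarnessLib

/-!
# Scaled Φ2 port, IV′/XVII′a: the CYCLE KIT of a small-cylinder edge in the big cylinder graph `G[C_R(t)]` of a `PlanarSkeletonFrmScaled`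
# (ray columns by `N`-steps, run = two corner escapes + a bounded connector inside the corner cylinder)

builds on p205010 (kernel theorem, internal audit signed; external expert review pending) — nothing in this file uses p205010; nothing here is a
claim about the open node `SamePDropOfSkeletonFrmScaled₁`.  Lane `prim-bschramm`, seat `prim-bschramm-p4` gen 16 (PART C3 of `P4-GENERAL.md` §38.5,
HOME/prim-bschramm-p4-g16/SCALED-PHI2-PORT.md "design correction").  Helper file (`--supports stmt-CriticalPhenomena-4575 --as helper`).  No probability.

The scaled twin of `PlanarSkeletonFrm.exists_kit_ray` (XVII §1) for the pair (`H = G[C_R(t)]`, edges inside `Λ_ℓ(t)`), `R ≥ ℓ + 2W + N`: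
* `EH`, `Eenh` — the subgraph class (both ends in `Λ_ℓ`) and the enhancement class (an end outside);
* columns = the two disjoint outward RAYS of XV′ (`exists_rayC`, `exists_dirs`), tops `p`, `q` just outside `Λ_ℓ` (`top_offsets`);
* run = corner escape of `p` (XII′) to the corner box `[ℓ+W+1, ℓ+W+N]²`, a CONNECTOR of bounded length inside the width-`W` cylinder around
  that corner (hypothesis `hM`, supplied by `exists_adjust_bound'` with `W = ℓ₀ + N` in the sequel), and the reversed corner escape of `q`; every
  run vertex has an offset `> ℓ` (outside `Λ_ℓ`), so columns meet the run only at their tops, and the run lies in `Λ_R`;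
* tails/zone exactly as in XVII: **`exists_kit_ray`**.
[cite: AizenmanGrimmett1991, Thm 1 (essential enhancements)] [cite: BalisterBollobasRiordan2014, §"bond percolation" p. 13] [cite: KozmaNitzan2024, §4 p. 26 ((29))]
-/

noncomputable section

namespace Summit.CriticalPhenomena.PercolationContinuityZ3.Theorems.Transplant

namespace PlanarSkeletonFrmScaled

open SimpleGraph Walk Literature.Probability.LatticeModels SubLoc
open Literature.Barriers.CriticalPhenomena (graphBall graphBall_finite graphBall_mono)
open scoped Classical

-- the scaled skeleton is called `Ψ` in this file
variable {V : Type} {G : SimpleGraph V} [G.LocallyFinite] (Ψ : PlanarSkeletonFrmScaled G) {t : V} {ℓ R : ℕ}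

/-! ## §1 The two edge classes of the pair `Λ_ℓ(t) ⊆ C_R(t)` -/

/-- **The subgraph class**: edges of the big cylinder graph `G[C_R(t)]` with both ends in the small cylinder `Λ_ℓ(t)`. [folklore] -/
def EH (t : V) (ℓ R : ℕ) : Set (Sym2 (Ψ.cyl t R)) :=
  {d | d ∈ (G.induce (Ψ.cyl t R)).edgeSet ∧ ∀ z ∈ d, Ψ.φ z.1 - Ψ.φ t ∈ box 2 ℓ}

/-- **The enhancement class**: edges of the big cylinder graph `G[C_R(t)]` with an end outside `Λ_ℓ(t)`. [folklore] -/
def Eenh (t : V) (ℓ R : ℕ) : Set (Sym2 (Ψ.cyl t R)) :=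
  {d | d ∈ (G.induce (Ψ.cyl t R)).edgeSet ∧ ¬ ∀ z ∈ d, Ψ.φ z.1 - Ψ.φ t ∈ box 2 ℓ}

/-! ## §2 Offsets -/

/-- **The offsets of a ray top**: the top `p` of the `i`-ray of `x ∈ Λ_ℓ` (first vertex outside `Λ_ℓ`, inside `Λ_{ℓ+N}`) has `i`-offset in
`(ℓ, ℓ + N]` and `j`-offset (`j ≠ i`) of absolute value `≤ ℓ`. [folklore] -/
theorem top_offsets {i j : Fin 2} (hij : j ≠ i) {x p : V} (hx : Ψ.φ x - Ψ.φ t ∈ box 2 ℓ) (hp : Ψ.φ p - Ψ.φ t ∉ box 2 ℓ)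
    (hpN : Ψ.φ p - Ψ.φ t ∈ box 2 (ℓ + Ψ.N)) (hφ : ∃ m : ℕ, 1 ≤ m ∧ Ψ.φ p = Ψ.φ x + Pi.single i (m : ℤ)) :
    ((ℓ : ℤ) < Ψ.φ p i - Ψ.φ t i ∧ Ψ.φ p i - Ψ.φ t i ≤ ℓ + Ψ.N) ∧ |Ψ.φ p j - Ψ.φ t j| ≤ ℓ := by
  obtain ⟨m, hm, hφp⟩ := hφ
  have hpi : Ψ.φ p i = Ψ.φ x i + m := by rw [hφp, Pi.add_apply, Pi.single_eq_same]
  have hpj : Ψ.φ p j = Ψ.φ x j := by rw [hφp, Pi.add_apply, Pi.single_eq_of_ne hij, add_zero]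
  have hxi := (mem_box.1 hx) i
  have hxj := (mem_box.1 hx) j
  have hpNi := (mem_box.1 hpN) i
  simp only [Pi.sub_apply] at hxi hxj hpNi
  push_cast at hpNi
  have hnot : ¬ (-(ℓ : ℤ) ≤ Ψ.φ p i - Ψ.φ t i ∧ Ψ.φ p i - Ψ.φ t i ≤ ℓ) := by
    intro h
    apply hp
    rw [mem_box]
    intro k
    rcases fin_two_cases_of_ne hij k with rfl | rfl
    · simpa only [Pi.sub_apply] using h
    · simp only [Pi.sub_apply]; rw [hpj]; exact hxj
  rw [hpi] at hnot hpNi ⊢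
  rw [hpj]
  have hm1 : (1 : ℤ) ≤ m := by exact_mod_cast hm
  refine ⟨⟨?_, hpNi.2⟩, abs_le.2 hxj⟩
  by_contra hle
  exact hnot ⟨by linarith [hxi.1], not_lt.1 hle⟩

/-- From offset bounds to membership: `i`-offset in `(ℓ, R]` and `j`-offset in `[−R, R]` put a vertex in `C_R(t)` and outside `Λ_ℓ(t)`. [folklore] -/
theorem mem_cyl_not_box {i j : Fin 2} (hij : j ≠ i) {z : V}
    (hi : (ℓ : ℤ) < Ψ.φ z i - Ψ.φ t i ∧ Ψ.φ z i - Ψ.φ t i ≤ R) (hj : -(R : ℤ) ≤ Ψ.φ z j - Ψ.φ t j ∧ Ψ.φ z j - Ψ.φ t j ≤ R) :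
    z ∈ Ψ.cyl t R ∧ Ψ.φ z - Ψ.φ t ∉ box 2 ℓ := by
  refine ⟨?_, fun h => ?_⟩
  · change Ψ.φ z - Ψ.φ t ∈ box 2 R
    rw [mem_box]
    intro k
    rcases fin_two_cases_of_ne hij k with rfl | rfl
    · simp only [Pi.sub_apply]; constructor <;> omega
    · simp only [Pi.sub_apply]; exact hj
  · have := (mem_box.1 h) i
    simp only [Pi.sub_apply] at this
    omega

/-! ## §3 The cycle kit of a subgraph edge with RAY columns and a CORNER run -/

/-- **THE CYCLE KIT of a small-cylinder edge `{x, y}` of a `PlanarSkeletonFrmScaled`**: columns = two disjoint outward rays by `N`-steps, run =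
two corner escapes + a connector of length `≤ Mb` inside the width-`W` cylinder around a corner (hypothesis `hM`); for every up-closed set `C` of
the big cylinder the columns satisfy the tail conditions of `CycleKit.exists_routeData_of_pivotal_of_tails`; zone inside `B_H(x, 6ℓ+4W+4N+9+Mb)`.
[cite: AizenmanGrimmett1991, Thm 1 (essential enhancements)] [cite: BalisterBollobasRiordan2014, §"bond percolation" p. 13] -/
theorem exists_kit_ray (hR : ℓ + Ψ.N ≤ R) {W : ℕ} (hRW : ℓ + 2 * W + Ψ.N ≤ R) {Mb : ℕ}
    (hM : ∀ w w' : V, Ψ.φ w' - Ψ.φ w ∈ box 2 Ψ.N → w' ∈ graphBall G w (8 * ℓ + 4 * W + 4 * Ψ.N + 11) →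
      ∃ P : G.Walk w w', P.length ≤ Mb ∧ ∀ z ∈ P.support, Ψ.φ z - Ψ.φ w ∈ box 2 W)
    (x y : Ψ.cyl t R) (hxy : s(x, y) ∈ Ψ.EH t ℓ R) :
    ∃ K : CycleKit (G.induce (Ψ.cyl t R)) (Ψ.Eenh t ℓ R) x y,
      (∀ C : Set (Ψ.cyl t R), (∀ z ∈ C, Ψ.φ z.1 - Ψ.φ t ∈ box 2 ℓ → Ψ.stpC t ℓ R hR 0 z ∈ C ∧ Ψ.stpC t ℓ R hR 1 z ∈ C) →
        (x ∈ C → ∀ w ∈ K.A.support, w ∈ C) ∧ (y ∈ C → ∀ w ∈ K.B.support, w ∈ C) ∧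
        (∀ (u : Ψ.cyl t R) (hu : u ∈ K.A.support), u ∈ C → ∀ w ∈ (K.A.dropUntil u hu).support, w ∈ C) ∧
        (∀ (u : Ψ.cyl t R) (hu : u ∈ K.B.reverse.support), u ∈ C →
          ∀ w ∈ (K.B.reverse.dropUntil u hu).support, w ∈ C)) ∧
      K.Z ⊆ graphBall (G.induce (Ψ.cyl t R)) x (6 * ℓ + 4 * W + 4 * Ψ.N + 9 + Mb) := by
  have hadj : (G.induce (Ψ.cyl t R)).Adj x y := hxy.1
  have hGadj : G.Adj x.1 y.1 := hadj
  have hxb : Ψ.φ x.1 - Ψ.φ t ∈ box 2 ℓ := hxy.2 x (Sym2.mem_mk_left _ _)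
  have hyb : Ψ.φ y.1 - Ψ.φ t ∈ box 2 ℓ := hxy.2 y (Sym2.mem_mk_right _ _)
  -- the two disjoint rays and their tops
  obtain ⟨iA, iB, hdisj⟩ := Ψ.exists_dirs x y hadj.ne
  obtain ⟨jA, hjA⟩ := Literature.Barriers.CriticalPhenomena.NonGibbs.exists_fin_two_ne iA
  obtain ⟨jB, hjB⟩ := Literature.Barriers.CriticalPhenomena.NonGibbs.exists_fin_two_ne iB
  obtain ⟨p, WA, hAP, hAl, hAsup, hAbox, hpout, hAinn, hAtail, hAall⟩ := Ψ.exists_rayC hR iA x hxb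
  obtain ⟨q, WB, hBP, hBl, hBsup, hBbox, hqout, hBinn, hBtail, hBall⟩ := Ψ.exists_rayC hR iB y hyb
  have hAB : ∀ w, w ∈ WA.support → w ∈ WB.support → False := fun w h1 h2 => hdisj w (hAsup w h1) (hBsup w h2)
  have hpx : p ≠ x := fun h => hpout (h ▸ hxb)
  have hqy' : q ≠ y := fun h => hqout (h ▸ hyb)
  obtain ⟨hpi, hpj⟩ := Ψ.top_offsets hjA hxb hpout (hAbox p WA.end_mem_support)
    ((hAsup p WA.end_mem_support).resolve_left hpx)
  obtain ⟨hqi, hqj⟩ := Ψ.top_offsets hjB hyb hqout (hBbox q WB.end_mem_support)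
    ((hBsup q WB.end_mem_support).resolve_left hqy')
  -- the two corner escapes
  obtain ⟨cp, Wp, hpl, hcpi, hcpj, hpsup⟩ := Ψ.exists_corner_escape t p.1 iA jA hjA ℓ W hpi hpj
  obtain ⟨cq, Wq, hql, hcqi, hcqj, hqsup⟩ := Ψ.exists_corner_escape t q.1 iB jB hjB ℓ W hqi hqj
  -- the connector between the two corner vertices
  have hcpk : ∀ k : Fin 2, (ℓ : ℤ) + W + 1 ≤ Ψ.φ cp k - Ψ.φ t k ∧ Ψ.φ cp k - Ψ.φ t k ≤ ℓ + W + Ψ.N := fun k => by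
    rcases fin_two_cases_of_ne hjA k with rfl | rfl
    · exact hcpi
    · exact hcpj
  have hcqk : ∀ k : Fin 2, (ℓ : ℤ) + W + 1 ≤ Ψ.φ cq k - Ψ.φ t k ∧ Ψ.φ cq k - Ψ.φ t k ≤ ℓ + W + Ψ.N := fun k => by
    rcases fin_two_cases_of_ne hjB k with rfl | rfl
    · exact hcqi
    · exact hcqj
  have hdiff : Ψ.φ cq - Ψ.φ cp ∈ box 2 Ψ.N := by
    rw [mem_box]
    intro k
    simp only [Pi.sub_apply]
    have h1 := hcpk k
    have h2 := hcqk k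
    constructor <;> linarith
  have hWAG : ∃ WAG : G.Walk x.1 p.1, WAG.length ≤ 2 * ℓ + 1 := by
    have h1 := Walk.length_map (Embedding.induce (Ψ.cyl t R)).toHom WA
    exact ⟨_, h1.le.trans hAl⟩
  have hWBG : ∃ WBG : G.Walk y.1 q.1, WBG.length ≤ 2 * ℓ + 1 := by
    have h1 := Walk.length_map (Embedding.induce (Ψ.cyl t R)).toHom WB
    exact ⟨_, h1.le.trans hBl⟩
  obtain ⟨WAG, hAGl⟩ := hWAG
  obtain ⟨WBG, hBGl⟩ := hWBG
  have hball : cq ∈ graphBall G cp (8 * ℓ + 4 * W + 4 * Ψ.N + 11) := by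
    refine ⟨((Wp.reverse.append WAG.reverse).append (Walk.cons hGadj WBG)).append Wq, ?_⟩
    simp only [Walk.length_append, Walk.length_reverse, Walk.length_cons]
    omega
  obtain ⟨WJ, hJl, hJsup⟩ := hM cp cq hdiff hball
  -- the run in `G` and its membership
  set M₀G : G.Walk p.1 q.1 := (Wp.append WJ).append Wq.reverse with hM₀G
  have hMmem : ∀ z ∈ M₀G.support, z ∈ Ψ.cyl t R ∧ Ψ.φ z - Ψ.φ t ∉ box 2 ℓ := by
    intro z hz
    simp only [hM₀G, Walk.mem_support_append_iff, Walk.support_reverse, List.mem_reverse] at hz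
    rcases hz with (hz | hz) | hz
    · have h := hpsup z hz
      exact Ψ.mem_cyl_not_box hjA ⟨h.1.1, by linarith [h.1.2]⟩ ⟨by linarith [h.2.1], by linarith [h.2.2]⟩
    · have h := (mem_box.1 (hJsup z hz))
      have h0 := h iA
      have h1 := h jA
      simp only [Pi.sub_apply] at h0 h1
      have hc0 := hcpk iA
      have hc1 := hcpk jA
      exact Ψ.mem_cyl_not_box hjA ⟨by linarith [h0.1], by linarith [h0.2]⟩ ⟨by linarith [h1.1], by linarith [h1.2]⟩
    · have h := hqsup z hz
      exact Ψ.mem_cyl_not_box hjB ⟨h.1.1, by linarith [h.1.2]⟩ ⟨by linarith [h.2.1], by linarith [h.2.2]⟩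
  -- the run in `H`, shortened to a path
  set M₀ : (G.induce (Ψ.cyl t R)).Walk p q := M₀G.induce (Ψ.cyl t R) (fun z hz => (hMmem z hz).1) with hM₀def
  have hmemM₀ : ∀ w, w ∈ M₀.support → w.1 ∈ M₀G.support := fun w hw => (PlanarSkeletonFrm.mem_support_induce _ _ w).1 hw
  have hM₀out : ∀ w ∈ M₀.support, Ψ.φ w.1 - Ψ.φ t ∉ box 2 ℓ := fun w hw => (hMmem w.1 (hmemM₀ w hw)).2
  set M := M₀.bypass with hM
  have hMout : ∀ w ∈ M.support, Ψ.φ w.1 - Ψ.φ t ∉ box 2 ℓ := fun w hw => hM₀out w (M₀.support_bypass_subset_support hw)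
  -- the kit
  have hpq : p ≠ q := by
    rintro rfl
    exact hAB p WA.end_mem_support WB.end_mem_support
  have hxp : x ≠ p := fun h => hpx h.symm
  have hqy : q ≠ y := hqy'
  have hAM : ∀ w, w ∈ WA.support → w ∈ M.support → w = p := fun w h1 h2 =>
    (hAinn w h1).elim id fun hin => absurd hin (hMout w h2)
  have hMB : ∀ w, w ∈ M.support → w ∈ WB.reverse.support → w = q := fun w h1 h2 => by
    rw [Walk.support_reverse, List.mem_reverse] at h2
    exact (hBinn w h2).elim id fun hin => absurd hin (hMout w h1)
  have hABr : ∀ w, w ∈ WA.support → w ∈ WB.reverse.support → False := fun w h1 h2 => by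
    rw [Walk.support_reverse, List.mem_reverse] at h2
    exact hAB w h1 h2
  have hME : ∀ d ∈ M.edges, d ∈ Ψ.Eenh t ℓ R := by
    intro d hd
    refine ⟨M.edges_subset_edgeSet hd, fun hall => ?_⟩
    induction d using Sym2.ind with
    | h u v => exact hMout u (M.fst_mem_support_of_mem_edges hd) (hall u (Sym2.mem_mk_left _ _))
  let K : CycleKit (G.induce (Ψ.cyl t R)) (Ψ.Eenh t ℓ R) x y :=
    ⟨p, q, WA, M, WB.reverse, hAP, M₀.bypass_isPath, hBP.reverse, hpq, hxp, hqy, hAM, hMB, hABr, hME, hadj.symm⟩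
  refine ⟨K, fun C hC => ⟨fun hxC => hAall C hC hxC, fun hyC w hw => ?_, hAtail C hC, ?_⟩, ?_⟩
  · change w ∈ WB.reverse.support at hw
    rw [Walk.support_reverse, List.mem_reverse] at hw
    exact hBall C hC hyC w hw
  · change ∀ (u : Ψ.cyl t R) (hu : u ∈ WB.reverse.reverse.support), u ∈ C →
      ∀ w ∈ (WB.reverse.reverse.dropUntil u hu).support, w ∈ C
    exact SubLoc.tails_of_eq (Walk.reverse_reverse WB).symm (hBtail C hC)
  -- the zone radius
  have hM₀l : M₀.length ≤ 4 * ℓ + 4 * W + 4 * Ψ.N + 8 + Mb := by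
    rw [hM₀def, PlanarSkeletonFrm.length_induce_eq, hM₀G]
    simp only [Walk.length_append, Walk.length_reverse]
    omega
  have hMl : M.length ≤ 4 * ℓ + 4 * W + 4 * Ψ.N + 8 + Mb := (M₀.length_bypass_le_length).trans hM₀l
  intro w hw
  change w ∈ WA.support ∨ w ∈ M.support ∨ w ∈ WB.reverse.support at hw
  rcases hw with hw | hw | hw
  · exact ⟨WA.takeUntil w hw, (WA.length_takeUntil_le_length hw).trans (by omega)⟩
  · have hw' : w ∈ (WA.append M).support := by rw [Walk.mem_support_append_iff]; exact Or.inr hw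
    refine ⟨(WA.append M).takeUntil w hw', ((WA.append M).length_takeUntil_le_length hw').trans ?_⟩
    rw [Walk.length_append]; omega
  · have hw' : w ∈ (Walk.cons hadj WB).support := by
      rw [Walk.support_cons, List.mem_cons]
      rw [Walk.support_reverse, List.mem_reverse] at hw
      exact Or.inr hw
    refine ⟨(Walk.cons hadj WB).takeUntil w hw', ((Walk.cons hadj WB).length_takeUntil_le_length hw').trans ?_⟩
    rw [Walk.length_cons]; omega

end PlanarSkeletonFrmScaled

end Summit.CriticalPhenomena.PercolationContinuityZ3.Theorems.Transplant

end
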